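import Mathlib
import HarnessLib
import Literature.AlgebraicGeometry.Motives.CurveThroughPoint
import Literature.AlgebraicGeometry.Motives.SubschemeCyclesRatLocalProofs
import Summits.Langlands.Langlands.Theses.SkinnerWilesDefectOne

/-!
# Nice-prime supply: dimension-one primes on a component, off a small closed locus

Route `SkinnerWilesDefectOne`, support item stmt-Langlands-14718
(`ProModularOfEisensteinSeed : EisensteinProModularSeed → ReducibleOrdinaryProModular`, "Skinner–Wiles'
Main Theorem at defect one GIVEN their step (II)").  The item's content is Skinner–Wiles steps
(I)+(III); step (III) runs on the commutative-algebra fact that **every irreducible component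
`C = V(𝔓)` of `Spec R_𝒟` of dimension `≥ 2` carries DIMENSION-ONE primes outside any closed subset
not containing it** — the reducible locus (SW, proof of Cor. 2.12: "Choose a prime `P ⊇ Q` of `R_𝒟`
having dimension one and such that `ρ_𝒟 mod P` is also irreducible"), or `V(c_{σ₀}) ∪ V(Y₁) ∪ … ∪ V(Y_t)`
(SW, proof of Prop. 4.1: "Let `𝔭 ⊇ Q₁` be a prime of dimension one not containing `c_{σ₀}, Y₁, …, Y_t`.
Such a `𝔭` always exists.").  In the engine line `steinberg_hyperplane` this is the supply of the
primes `𝔭₁ ∈ Y ∖ (R^red ∪ V(p))` of stubs S4/S5.  It is proved here for an ARBITRARY noetherian local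
ring (no catenarity, no structure of `Λ_F = 𝒪⟦T₁,T₂,Y₁,Y₂⟧` used), which is what the defect-one
arena requires.

Main results (all sorry-free; `R` noetherian local; "dimension one" = `ringKrullDim (R ⧸ 𝔭) = 1`):

* `exists_isPrime_ringKrullDim_quotient_eq_one_not_le` — above a prime `𝔓` with `dim R/𝔓 ≥ 2`
  and off `V(I)` for any `I ⊄ 𝔓` there is a prime `𝔭 ⊇ 𝔓` of dimension one with `I ⊄ 𝔭`
  (for a domain take `𝔓 = 0`, `I ≠ 0`);
* `exists_le_ringKrullDim_quotient_eq_one_notMem` — the same with a CLOSED subset `Z ∌ 𝔓` of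
  `Spec R` in place of `V(I)`; `…_notMem_notMem` (two closed sets), `…_notMem_not_mem` (and one
  avoided element, e.g. `p`: characteristic-zero dimension-one primes), `…_notMem_forall_not_mem`
  (and finitely many avoided elements: SW's `c_{σ₀}, Y₁, …, Y_t`);
* `exists_le_ringKrullDim_quotient_eq_one_notMem_of_dim_le` — the Skinner–Wiles numerology:
  `dim R/𝔓 ≥ n + 1`, `n ≥ 1`, and `Z` closed with `dim R/𝔮 ≤ n` for all `𝔮 ∈ Z` (the shape of
  `SmallReducibleSteinbergLocus`, `n = 3`, against components of dimension `≥ 4 = dim Λ_F − l₀`)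
  ⟹ a dimension-one prime above `𝔓` off `Z`.

Proof: induction on `dim R/𝔓` — by the tree's `exists_isPrime_height_eq_one_le_not_le` (prime
avoidance + Krull's principal ideal theorem) the local domain `R/𝔓` has a HEIGHT-one prime not
containing `I·(R/𝔓) ≠ 0`; its pull-back `𝔮 ⊋ 𝔓` has `I ⊄ 𝔮`, `𝔮 ≠ 𝔪` and `dim R/𝔮 + 1 ≤ dim R/𝔓`
(`ringKrullDim_succ_le_of_surjective`), so either `dim R/𝔮 = 1` already or the induction hypothesis
applies above `𝔮` (`exists_isPrime_lt_not_le_ne_maximalIdeal`, `ringKrullDim_quotient_add_one_le_of_lt`).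

References: C. M. Skinner, A. J. Wiles, *Residually reducible representations and modular forms*,
Publ. Math. IHÉS 89 (1999) 5–126: §2.4, proof of Cor. 2.12 (p. 23) and §4.3, proof of Prop. 4.1
(p. 65). [SkinnerWiles1999]  H. Matsumura, *Commutative Ring Theory* (1986), Thm. 13.5 (Krull).
[Matsumura1987]
-/


set_option linter.dupNamespace false -- project-wide option (lakefile weak.linter.dupNamespace); `Summit.Langlands.Langlands` is the mandated namespace

namespace Summit.Langlands.Langlands.Theorems

open IsLocalRing

universe u

/-- **Height one ⟹ dimension drops.**  For a prime `𝔓` and a prime `𝔮 ⊋ 𝔓` (e.g. the pull-back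
of a height-one prime of the domain `R/𝔓`), `dim R/𝔮 + 1 ≤ dim R/𝔓`. [folklore] -/
theorem ringKrullDim_quotient_add_one_le_of_lt {R : Type u} [CommRing R] {𝔓 𝔮 : Ideal R}
    [𝔓.IsPrime] (h : 𝔓 < 𝔮) : ringKrullDim (R ⧸ 𝔮) + 1 ≤ ringKrullDim (R ⧸ 𝔓) := by
  obtain ⟨x, hx𝔮, hx𝔓⟩ := Set.exists_of_ssubset h
  -- `R/𝔮` is the quotient of the domain `R/𝔓` by an ideal containing the nonzero element `x̄`
  have e := DoubleQuot.quotQuotEquivQuotOfLE h.le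
  rw [← ringKrullDim_eq_of_ringEquiv e]
  refine ringKrullDim_succ_le_of_surjective (Ideal.Quotient.mk (𝔮.map (Ideal.Quotient.mk 𝔓)))
    Ideal.Quotient.mk_surjective (r := Ideal.Quotient.mk 𝔓 x) ?_ ?_
  · exact mem_nonZeroDivisors_of_ne_zero fun hx0 => hx𝔓 (Ideal.Quotient.eq_zero_iff_mem.mp hx0)
  · exact Ideal.Quotient.eq_zero_iff_mem.mpr (Ideal.mem_map_of_mem _ hx𝔮)

/-- **A prime strictly between**: above a prime `𝔓` with `dim R/𝔓 ≥ 2` (in a noetherian local ring)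
and off `V(I)` for `I ⊄ 𝔓` there is a prime `𝔮 ⊋ 𝔓` with `I ⊄ 𝔮` and `𝔮 ≠ 𝔪` — the pull-back of a
HEIGHT-one prime of the local domain `R/𝔓` avoiding `I·(R/𝔓)` (the tree's
`exists_isPrime_height_eq_one_le_not_le`: prime avoidance and Krull's principal ideal theorem).
[folklore] -/
theorem exists_isPrime_lt_not_le_ne_maximalIdeal {R : Type u} [CommRing R] [IsNoetherianRing R]
    [IsLocalRing R] (𝔓 : Ideal R) [𝔓.IsPrime] (h𝔓 : (2 : WithBot ℕ∞) ≤ ringKrullDim (R ⧸ 𝔓))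
    {I : Ideal R} (hI : ¬ I ≤ 𝔓) :
    ∃ 𝔮 : Ideal R, 𝔮.IsPrime ∧ 𝔓 < 𝔮 ∧ ¬ I ≤ 𝔮 ∧ 𝔮 ≠ maximalIdeal R := by
  haveI : IsLocalRing (R ⧸ 𝔓) :=
    IsLocalRing.of_surjective' (Ideal.Quotient.mk 𝔓) Ideal.Quotient.mk_surjective
  -- `dim R/𝔓 = height 𝔪_{R/𝔓} ≥ 2`
  obtain ⟨m, hm⟩ := Literature.AlgebraicGeometry.Motives.exists_ringKrullDim_eq_nat (R ⧸ 𝔓)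
  have h2m : 2 ≤ m := by
    rw [hm] at h𝔓
    exact_mod_cast h𝔓
  have h𝔪 : (2 : ℕ∞) ≤ (maximalIdeal (R ⧸ 𝔓)).height := by
    have h := IsLocalRing.maximalIdeal_height_eq_ringKrullDim (R := R ⧸ 𝔓)
    rw [hm] at h
    have h' : (maximalIdeal (R ⧸ 𝔓)).height = m := by exact_mod_cast h
    rw [h']
    exact_mod_cast h2m
  -- a height-one prime `𝔮'` of `R/𝔓` not containing `I·(R/𝔓) ≠ 0`
  have hI' : I.map (Ideal.Quotient.mk 𝔓) ≠ ⊥ := by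
    rw [Ne, Ideal.map_eq_bot_iff_le_ker, Ideal.mk_ker]
    exact hI
  obtain ⟨𝔮', h𝔮'p, h𝔮'1, -, hI𝔮'⟩ :=
    Literature.AlgebraicGeometry.Motives.exists_isPrime_height_eq_one_le_not_le
      (maximalIdeal (R ⧸ 𝔓)) h𝔪 hI'
  haveI := h𝔮'p
  refine ⟨𝔮'.comap (Ideal.Quotient.mk 𝔓), Ideal.comap_isPrime _ _, ?_, ?_, ?_⟩
  · -- `𝔓 = comap ⊥ < comap 𝔮'` since `𝔮' ≠ ⊥` (height one)
    have h𝔮'ne : 𝔮' ≠ ⊥ := Ideal.ne_bot_of_height_eq_one h𝔮'1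
    refine lt_of_le_of_ne (fun x hx => ?_) fun heq => h𝔮'ne ?_
    · rw [Ideal.mem_comap, Ideal.Quotient.eq_zero_iff_mem.mpr hx]
      exact Submodule.zero_mem _
    · rw [← Ideal.map_comap_of_surjective (Ideal.Quotient.mk 𝔓) Ideal.Quotient.mk_surjective 𝔮',
        ← heq, Ideal.map_eq_bot_iff_le_ker, Ideal.mk_ker]
  · exact fun hI𝔮 => hI𝔮' (Ideal.map_le_iff_le_comap.mpr hI𝔮)
  · -- `𝔮' ≠ 𝔪_{R/𝔓}` (height `1` versus `≥ 2`), and `comap 𝔪_{R/𝔓} = 𝔪_R`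
    intro heq
    have h𝔮'𝔪 : 𝔮' = maximalIdeal (R ⧸ 𝔓) := by
      rw [← Ideal.map_comap_of_surjective (Ideal.Quotient.mk 𝔓) Ideal.Quotient.mk_surjective 𝔮',
        heq]
      exact (IsLocalRing.map_maximalIdeal_of_surjective _ Ideal.Quotient.mk_surjective)
    rw [h𝔮'𝔪] at h𝔮'1
    rw [h𝔮'1] at h𝔪
    exact absurd h𝔪 (by decide)

/-- The induction behind the supply lemma (on `d ≥ dim R/𝔓`, inside the fixed ring `R`). -/
private theorem exists_dimOne_aux {R : Type u} [CommRing R] [IsNoetherianRing R] [IsLocalRing R]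
    (d : ℕ) : ∀ (𝔓 : Ideal R) [𝔓.IsPrime], ringKrullDim (R ⧸ 𝔓) ≤ d →
      (2 : WithBot ℕ∞) ≤ ringKrullDim (R ⧸ 𝔓) → ∀ I : Ideal R, ¬ I ≤ 𝔓 →
        ∃ 𝔭 : Ideal R, 𝔭.IsPrime ∧ 𝔓 ≤ 𝔭 ∧ ringKrullDim (R ⧸ 𝔭) = 1 ∧ ¬ I ≤ 𝔭 := by
  induction d with
  | zero =>
    intro 𝔓 _ hd h2 I hI
    have h : (2 : WithBot ℕ∞) ≤ (0 : ℕ) := h2.trans hd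
    exact absurd h (by decide)
  | succ d ih =>
    intro 𝔓 _ hd h2 I hI
    -- a prime `𝔮 ⊋ 𝔓`, `𝔮 ≠ 𝔪`, with `I ⊄ 𝔮`
    obtain ⟨𝔮, h𝔮p, h𝔓𝔮, hI𝔮, h𝔮𝔪⟩ := exists_isPrime_lt_not_le_ne_maximalIdeal 𝔓 h2 hI
    haveI := h𝔮p
    haveI : IsLocalRing (R ⧸ 𝔮) :=
      IsLocalRing.of_surjective' (Ideal.Quotient.mk 𝔮) Ideal.Quotient.mk_surjective
    haveI : IsLocalRing (R ⧸ 𝔓) :=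
      IsLocalRing.of_surjective' (Ideal.Quotient.mk 𝔓) Ideal.Quotient.mk_surjective
    -- `1 ≤ dim R/𝔮 ≤ d`
    obtain ⟨m, hm⟩ := Literature.AlgebraicGeometry.Motives.exists_ringKrullDim_eq_nat (R ⧸ 𝔓)
    obtain ⟨n, hn⟩ := Literature.AlgebraicGeometry.Motives.exists_ringKrullDim_eq_nat (R ⧸ 𝔮)
    have hdrop := ringKrullDim_quotient_add_one_le_of_lt h𝔓𝔮
    rw [hn, hm] at hdrop
    rw [hm] at hd
    have hnm : n + 1 ≤ m := by exact_mod_cast hdrop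
    have hmd : m ≤ d + 1 := by exact_mod_cast hd
    have hn1 : 1 ≤ n := by
      by_contra hlt
      have hn0 : n = 0 := by omega
      rw [hn0] at hn
      haveI : Ring.KrullDimLE 0 (R ⧸ 𝔮) := by
        rw [Ring.krullDimLE_iff]
        exact_mod_cast hn.le
      have hF : IsField (R ⧸ 𝔮) := Ring.KrullDimLE.isField_of_isDomain
      exact h𝔮𝔪 (IsLocalRing.eq_maximalIdeal
        ((Ideal.Quotient.maximal_ideal_iff_isField_quotient 𝔮).mpr hF))
    by_cases hn2 : 2 ≤ n
    · -- induction above `𝔮`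
      have hdim' : ringKrullDim (R ⧸ 𝔮) ≤ d := by
        rw [hn]
        exact_mod_cast (by omega : n ≤ d)
      have h2' : (2 : WithBot ℕ∞) ≤ ringKrullDim (R ⧸ 𝔮) := by
        rw [hn]
        exact_mod_cast hn2
      obtain ⟨𝔭, h𝔭p, h𝔮𝔭, h𝔭1, hI𝔭⟩ := ih 𝔮 hdim' h2' I hI𝔮
      exact ⟨𝔭, h𝔭p, h𝔓𝔮.le.trans h𝔮𝔭, h𝔭1, hI𝔭⟩
    · -- `dim R/𝔮 = 1`: take `𝔭 = 𝔮`
      refine ⟨𝔮, h𝔮p, h𝔓𝔮.le, ?_, hI𝔮⟩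
      rw [hn, (by omega : n = 1)]
      rfl

/-- **Dimension-one primes on a component, off `V(I)`.**  Let `R` be a noetherian local ring,
`𝔓` a prime with `dim R/𝔓 ≥ 2` (e.g. a minimal prime = an irreducible component of `Spec R` of
dimension `≥ 2`) and `I ⊄ 𝔓` an ideal (a closed subset `V(I)` not containing the component).  Then
there is a prime `𝔭 ⊇ 𝔓` of DIMENSION ONE (`dim R/𝔭 = 1`) with `I ⊄ 𝔭` — a dimension-one point of
the component outside `V(I)`.  (Height one in `R/𝔓` would not do when `dim R/𝔓 ≥ 3`: Skinner–Wiles'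
nice primes are the `𝔭` with `R_𝒟/𝔭` one-dimensional; the proof iterates the height-one step.)
[cite: SkinnerWiles1999, §2.4 proof of Cor. 2.12; §4.3 proof of Prop. 4.1] -/
theorem exists_isPrime_ringKrullDim_quotient_eq_one_not_le {R : Type u} [CommRing R]
    [IsNoetherianRing R] [IsLocalRing R] (𝔓 : Ideal R) [𝔓.IsPrime]
    (h𝔓 : (2 : WithBot ℕ∞) ≤ ringKrullDim (R ⧸ 𝔓)) {I : Ideal R} (hI : ¬ I ≤ 𝔓) :
    ∃ 𝔭 : Ideal R, 𝔭.IsPrime ∧ 𝔓 ≤ 𝔭 ∧ ringKrullDim (R ⧸ 𝔭) = 1 ∧ ¬ I ≤ 𝔭 := by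
  haveI : IsLocalRing (R ⧸ 𝔓) :=
    IsLocalRing.of_surjective' (Ideal.Quotient.mk 𝔓) Ideal.Quotient.mk_surjective
  obtain ⟨m, hm⟩ := Literature.AlgebraicGeometry.Motives.exists_ringKrullDim_eq_nat (R ⧸ 𝔓)
  exact exists_dimOne_aux m 𝔓 hm.le h𝔓 I hI

/-- **Dimension-one points of a component off a closed subset of `Spec R`.**  `R` noetherian
local, `C ∈ Spec R` with `dim R/C ≥ 2`, `Z ⊆ Spec R` closed with `C ∉ Z`: some `𝔭 ≥ C`
(a point of the closure of `C`) has `dim R/𝔭 = 1` and `𝔭 ∉ Z`.  With `Z` the reducible locus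
this is "every component of `Spec R_𝒟` not contained in the reducible locus carries
dimension-one primes `𝔭` with `ρ_𝔭` irreducible". [cite: SkinnerWiles1999, §2.4 proof of Cor. 2.12; §4.3 proof of Prop. 4.1] -/
theorem exists_le_ringKrullDim_quotient_eq_one_notMem {R : Type u} [CommRing R]
    [IsNoetherianRing R] [IsLocalRing R] (C : PrimeSpectrum R)
    (hC : (2 : WithBot ℕ∞) ≤ ringKrullDim (R ⧸ C.asIdeal)) {Z : Set (PrimeSpectrum R)}
    (hZ : IsClosed Z) (hCZ : C ∉ Z) :
    ∃ 𝔭 : PrimeSpectrum R, C ≤ 𝔭 ∧ ringKrullDim (R ⧸ 𝔭.asIdeal) = 1 ∧ 𝔭 ∉ Z := by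
  -- `Z = V(J)` with `J = vanishingIdeal Z`, and `C ∉ Z` means `J ⊄ C`
  have hZeq : PrimeSpectrum.zeroLocus (PrimeSpectrum.vanishingIdeal Z : Set R) = Z := by
    rw [PrimeSpectrum.zeroLocus_vanishingIdeal_eq_closure, hZ.closure_eq]
  have hJ : ¬ PrimeSpectrum.vanishingIdeal Z ≤ C.asIdeal := by
    intro hle
    apply hCZ
    rw [← hZeq]
    exact hle
  obtain ⟨𝔭, h𝔭p, hC𝔭, h𝔭1, hJ𝔭⟩ :=
    exists_isPrime_ringKrullDim_quotient_eq_one_not_le C.asIdeal hC hJ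
  refine ⟨⟨𝔭, h𝔭p⟩, (PrimeSpectrum.asIdeal_le_asIdeal _ _).mp hC𝔭, h𝔭1, fun h𝔭Z => hJ𝔭 ?_⟩
  rw [← hZeq] at h𝔭Z
  exact h𝔭Z

/-- **Two avoided closed sets** (e.g. the reducible locus and `V(p)`: a CHARACTERISTIC-ZERO
dimension-one prime with `ρ_𝔭` irreducible on a component of characteristic zero not inside the
reducible locus — the `𝒪′`-points used by stub S5 of line `steinberg_hyperplane`).
[cite: SkinnerWiles1999, §2.4 proof of Cor. 2.12; §4.3 proof of Prop. 4.1] -/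
theorem exists_le_ringKrullDim_quotient_eq_one_notMem_notMem {R : Type u}
    [CommRing R] [IsNoetherianRing R] [IsLocalRing R] (C : PrimeSpectrum R)
    (hC : (2 : WithBot ℕ∞) ≤ ringKrullDim (R ⧸ C.asIdeal)) {Z Z' : Set (PrimeSpectrum R)}
    (hZ : IsClosed Z) (hZ' : IsClosed Z') (hCZ : C ∉ Z) (hCZ' : C ∉ Z') :
    ∃ 𝔭 : PrimeSpectrum R, C ≤ 𝔭 ∧ ringKrullDim (R ⧸ 𝔭.asIdeal) = 1 ∧ 𝔭 ∉ Z ∧ 𝔭 ∉ Z' := by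
  obtain ⟨𝔭, hC𝔭, h𝔭1, h𝔭Z⟩ :=
    exists_le_ringKrullDim_quotient_eq_one_notMem C hC (hZ.union hZ')
      (fun h => h.elim hCZ hCZ')
  exact ⟨𝔭, hC𝔭, h𝔭1, fun h => h𝔭Z (Or.inl h), fun h => h𝔭Z (Or.inr h)⟩

/-- **A prime not containing a given element** (`x ∉ C`, e.g. `x = p` on a characteristic-zero
component): the avoided closed set `V(x)`. [folklore] -/
theorem exists_le_ringKrullDim_quotient_eq_one_notMem_not_mem {R : Type u}
    [CommRing R] [IsNoetherianRing R] [IsLocalRing R] (C : PrimeSpectrum R)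
    (hC : (2 : WithBot ℕ∞) ≤ ringKrullDim (R ⧸ C.asIdeal)) {Z : Set (PrimeSpectrum R)}
    (hZ : IsClosed Z) (hCZ : C ∉ Z) {x : R} (hx : x ∉ C.asIdeal) :
    ∃ 𝔭 : PrimeSpectrum R, C ≤ 𝔭 ∧ ringKrullDim (R ⧸ 𝔭.asIdeal) = 1 ∧ 𝔭 ∉ Z ∧ x ∉ 𝔭.asIdeal := by
  have hx' : C ∉ PrimeSpectrum.zeroLocus {x} := by
    rwa [PrimeSpectrum.mem_zeroLocus, Set.singleton_subset_iff]
  obtain ⟨𝔭, hC𝔭, h𝔭1, h𝔭Z, h𝔭x⟩ :=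
    exists_le_ringKrullDim_quotient_eq_one_notMem_notMem C hC hZ
      (PrimeSpectrum.isClosed_zeroLocus {x}) hCZ hx'
  refine ⟨𝔭, hC𝔭, h𝔭1, h𝔭Z, ?_⟩
  rwa [PrimeSpectrum.mem_zeroLocus, Set.singleton_subset_iff] at h𝔭x

/-- **Finitely many avoided elements** (Skinner–Wiles: "Let `𝔭 ⊇ Q₁` be a prime of dimension
one not containing `c_{σ₀}, Y₁, …, Y_t`.  Such a `𝔭` always exists."): for a finite set `s` of
elements of `R` none of which lies in `C`, some dimension-one `𝔭 ≥ C` off the closed set `Z ∌ C`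
contains no element of `s` (avoid `V(∏ s)`, `∏ s ∉ C` by primality).
[cite: SkinnerWiles1999, §4.3 proof of Prop. 4.1] -/
theorem exists_le_ringKrullDim_quotient_eq_one_notMem_forall_not_mem {R : Type u}
    [CommRing R] [IsNoetherianRing R] [IsLocalRing R] (C : PrimeSpectrum R)
    (hC : (2 : WithBot ℕ∞) ≤ ringKrullDim (R ⧸ C.asIdeal)) {Z : Set (PrimeSpectrum R)}
    (hZ : IsClosed Z) (hCZ : C ∉ Z) (s : Finset R) (hs : ∀ x ∈ s, x ∉ C.asIdeal) :
    ∃ 𝔭 : PrimeSpectrum R, C ≤ 𝔭 ∧ ringKrullDim (R ⧸ 𝔭.asIdeal) = 1 ∧ 𝔭 ∉ Z ∧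
      ∀ x ∈ s, x ∉ 𝔭.asIdeal := by
  have hprod : s.prod (fun x => x) ∉ C.asIdeal := by
    rw [C.isPrime.prod_mem_iff_exists_mem]
    rintro ⟨x, hxs, hxC⟩
    exact hs x hxs hxC
  obtain ⟨𝔭, hC𝔭, h𝔭1, h𝔭Z, h𝔭x⟩ :=
    exists_le_ringKrullDim_quotient_eq_one_notMem_not_mem C hC hZ hCZ hprod
  refine ⟨𝔭, hC𝔭, h𝔭1, h𝔭Z, fun x hxs hx𝔭 => h𝔭x ?_⟩
  obtain ⟨c, hc⟩ := Finset.dvd_prod_of_mem (fun x => x) hxs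
  rw [hc]
  exact Ideal.mul_mem_right _ _ hx𝔭

/-- **Skinner–Wiles numerology.**  `R` noetherian local, `C ∈ Spec R` with `dim R/C ≥ n + 1`
(`n ≥ 1`; the components of `Spec R_𝒟` have dimension `≥ 4 = dim Λ_F − l₀`) and `Z ⊆ Spec R`
CLOSED all of whose points have `dim R/𝔮 ≤ n` (the reducible locus has dimension `≤ 3` — the
shape of `SmallReducibleSteinbergLocus`): then `C ∉ Z` for dimension reasons and some
dimension-one `𝔭 ≥ C` lies off `Z`.  Closedness of `Z` is essential (the set of ALL primes of
dimension `≤ 1` satisfies the dimension bound and contains every candidate).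
[cite: SkinnerWiles1999, §2.4 proof of Cor. 2.12; §4.3 proof of Prop. 4.1] -/
theorem exists_le_ringKrullDim_quotient_eq_one_notMem_of_dim_le {R : Type u}
    [CommRing R] [IsNoetherianRing R] [IsLocalRing R] (C : PrimeSpectrum R) {n : ℕ} (hn : 1 ≤ n)
    (hC : ((n + 1 : ℕ) : WithBot ℕ∞) ≤ ringKrullDim (R ⧸ C.asIdeal)) {Z : Set (PrimeSpectrum R)}
    (hZ : IsClosed Z) (hZdim : ∀ 𝔮 ∈ Z, ringKrullDim (R ⧸ 𝔮.asIdeal) ≤ n) :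
    ∃ 𝔭 : PrimeSpectrum R, C ≤ 𝔭 ∧ ringKrullDim (R ⧸ 𝔭.asIdeal) = 1 ∧ 𝔭 ∉ Z := by
  have h2 : (2 : WithBot ℕ∞) ≤ ringKrullDim (R ⧸ C.asIdeal) :=
    le_trans (by exact_mod_cast (by omega : 2 ≤ n + 1)) hC
  refine exists_le_ringKrullDim_quotient_eq_one_notMem C h2 hZ fun hCZ => ?_
  have h := (hC.trans (hZdim C hCZ))
  have h' : n + 1 ≤ n := by exact_mod_cast h
  omega

end Summit.Langlands.Langlands.Theorems
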